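import Literature.Probability.LatticeModels.MedialCycleSeparation
import Literature.Probability.LatticeModels.LatticeDobrushinBox
import Summits.CriticalPhenomena.CardyFormulaZ2.Theorems.CardyComplexConeDefs

/-!
# The planar passage lemma at the free wall of the three-sided box
(line `qkz-strip-boundary-arm` of crux `CardyComplexCone.EdgePrecompact`, stmt-CriticalPhenomena-11387;
necessity certificate "UniformInnerEnvelope ⇒ cube-root half-plane one-arm bound", piece N3,
registered sub-goal `threeSided_wallDart_of_joined`)

Setting: the three-sided box `LatticeDobrushin.threeSided W H` (sites `[0, W] × [-1, H]`, wired on its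
left column, top row and right column — the arc `A`; the bottom row `[0, W] × {-1}` is the free arc `B`),
ONE configuration `ω` read in the completed configuration `β = E.bcBondConfig ω` of the realisation
`E = (threeSided W H).toDobrushin`, and the cut orbit `cornerOrbit β c₀ 0, …, N - 1` of Smirnov's
successor map from the start corner `c₀` up to the exit time `N` (= the medial exploration path).

**Theorem `threeSided_wallDart_of_joined`.** If the wall-adjacent site `(x, 0)`, `0 < x < W`, is joined
to the wired arc `A` by `β`-open edges, then the east-going wall dart `d = ((x, 0), 3)` (the corner of
`(x, 0)` in the bottom face `(x, -1)`) is a dart of the exploration: `cornerOrbit β c₀ k = d` for some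
`k < N`.

Proof (planar duality of the loop representation, by the winding numbers of
`Literature/Probability/LatticeModels/MedialCycleSeparation.lean`). Suppose not. The wall edge below
`(x, 0)` is closed, so `d` is the successor of `q = ((x, 0), 2)`; both have inner faces, hence `q` is not
on the interface cycle either (inner corners of the interface cycle are exploration darts,
`isInnerFace_cornerOrbit_iff`), and the cycle `Z` of the turning rule through `q` misses the interface
cycle. No corner of `Z` sits at a `B`-vertex (open edges avoid `B`, crossing a closed edge keeps the
vertex). Let `w` be the winding number of the closed perturbed polygon of `Z` (`cyLoop`). Then
(A) `w (x, 0) ≠ w (centre of f)`, `f = (x - 1, -1)` the face of `q`: the polygon crosses the half-diagonal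
from `(x, 0)` into `f` exactly once, transversally; (B) `w (x, -1) = w (centre of f)`: the only dart
piece meeting the half-diagonal from `(x, -1)` into `f` would be the corner `((x, -1), 1)` at a
`B`-vertex; (C) `w (x, 0) = w a = w (c₀.1)`: open edges miss the polygon, and the wired arc is joined to
the vertex of the start corner by `A`–`A` edges, all open; (D) `w (c₀.1) = w (b₀) = w (0, -1) = w (x, -1)`,
`b₀ ∈ B` the lower endpoint of the start edge `e_a`: a lattice edge meets the polygon only at a
connector across it, i.e. only if one of its two arriving corners lies on `Z` — for `e_a` these are the
cross-predecessor of `c₀` (whose successor `c₀` is not on `Z`) and a corner at `b₀ ∈ B`, for the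
bottom-row edges both sit at `B`-vertices. (A)–(D) contradict each other.

References: S. Smirnov, C. R. Acad. Sci. Paris 333 (2001), §2 (the exploration process); G. Grimmett,
*The Random-Cluster Model* (2006), §6.1 (loops separate clusters from dual clusters).
-/

namespace Summit.CriticalPhenomena.CardyFormulaZ2.Cruxes.EdgePrecompact.QkzStripBoundaryArm

open MeasureTheory Filter Set Metric
open scoped Topology BigOperators Pointwise
open Literature.Probability.LatticeModels Literature.Probability.Percolation
open Literature.Probability.RandomPlanarGeometry (DobrushinDomain)
open Summit.CriticalPhenomena.CardyFormulaZ2.Theses.CardyComplexCone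
open Literature.Topology.PlaneTopology (wind)

noncomputable section

/-! ## Generic facts about the closed perturbed polygon of a cycle of the turning rule -/

/-- A connector of the polygon of the orbit of `q` meets the lattice edge `{u, w}` only if that edge is
the target edge of the corresponding corner (the crossed edge of a vertex turn; face connectors miss
every lattice edge). -/
private theorem cTgt_eq_of_mem_cyConn_N3 {β : BondConfig (Site 2)} {q : Site 2 × Fin 4} (m : ℕ)
    {u w : Site 2} (hadj : (zdGraph 2).Adj u w) {z : ℂ} (hz : z ∈ cyConn β q m)
    (hz' : z ∈ edgeTrace s(u, w)) : cTgt (cornerOrbit β q m) = s(u, w) := by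
  rcases cyConn_cases m hz with ⟨I, J, hJI, -, hv, hcol, -, hsrc, hshape⟩ | ⟨I, J, -, -, hshape⟩
  · obtain ⟨huj, hwj, hui⟩ := hshape.edge_eq hadj hz'
    rw [hcol] at hui
    have hc2 : IsCorner (cyV β q m) (cyF β q (m + 1)) := hv ▸ isCorner_cy (m + 1)
    have hedge : s(u, w) = cornerEdge (cyV β q m) (cyF β q (m + 1)) I :=
      IsMedialExploration.cornerEdge_eq_of_coords hc2 hJI huj hwj hui
    rw [hedge, ← hsrc, ← hv, ← cSrc_nextCorner]
    exact (cornerSource_faceAt _ _).symm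
  · exact absurd hz' (hshape.not_mem_edgeTrace hadj)

/-- **The endpoints of a lattice edge at which no corner of the cycle arrives have equal winding
numbers**: dart pieces miss every lattice edge, and a connector meets the edge only if it is the target
edge of its corner. -/
private theorem wind_cyLoop_eq_of_adj_N3 {β : BondConfig (Site 2)} {q : Site 2 × Fin 4} {n : ℕ}
    (h : cornerOrbit β q (n + 1) = q) {u w : Site 2} (hadj : (zdGraph 2).Adj u w)
    (hne : ∀ m, cTgt (cornerOrbit β q m) ≠ s(u, w)) :
    wind (fun t => (cyLoop n h).extend t - Site.toComplex u) =
      wind (fun t => (cyLoop n h).extend t - Site.toComplex w) :=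
  wind_cyLoop_eq_of_segment h fun z hz => not_mem_range_cyLoop h
    (fun j _ hzj => cyDart_disjoint_edgeTrace j hadj hzj (by rw [edgeTrace_mk]; exact hz))
    (fun j _ hzj => hne j (cTgt_eq_of_mem_cyConn_N3 j hadj hzj (by rw [edgeTrace_mk]; exact hz)))

/-- **(A) The vertex of `q` and the centre of its face have different winding numbers** with respect
to the closed polygon of the cycle through `q` (minimal period `n + 1`): the polygon crosses the
half-diagonal from `q.1` into `cFace q` exactly once, by its first dart piece, transversally
(`crossInc_dartSeg_ne_zero`); the other dart pieces miss it by minimality of the period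
(`cy_eq_of_mem_halfDiag`), connectors miss half-diagonals. Verbatim the first half of
`medialCycle_separates_holds`. -/
private theorem wind_ne_N3 {β : BondConfig (Site 2)} {q : Site 2 × Fin 4} {n : ℕ}
    (hP : cornerOrbit β q (n + 1) = q) (hPmin : ∀ s, 0 < s → s < n + 1 → cornerOrbit β q s ≠ q) :
    wind (fun t => (cyLoop n hP).extend t - Site.toComplex q.1) ≠
      wind (fun t => (cyLoop n hP).extend t - faceCenter (cFace q)) := by
  set γ := cyLoop (β := β) (q := q) n hP with hγ
  set ℓ := Site.toComplex q.1
  set r := faceCenter (cFace q)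
  have hhalf : halfDiag q.1 (faceAt q.1 q.2) = segment ℝ ℓ r := rfl
  have hd : ∀ j, 1 ≤ j → j ≤ n → ∀ z ∈ cyDart β q j, z ∉ segment ℝ ℓ r := by
    intro j hj1 hjn z hz hz'
    rw [← hhalf] at hz'
    have := cy_eq_of_mem_halfDiag j hz hz'
    exact hPmin j hj1 (by omega) (this.trans (Prod.ext rfl rfl))
  have hc : ∀ j ≤ n, ∀ z ∈ cyConn β q j, z ∉ segment ℝ ℓ r := by
    intro j _ z hz hz'
    rw [← hhalf] at hz'
    exact cyConn_disjoint_halfDiag j (isCorner_faceAt q.1 q.2) hz hz'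
  have hℓγ : ℓ ∉ range γ := not_mem_range_cyLoop hP (fun j _ => toComplex_not_mem_cyDart _ _)
    (fun j _ => toComplex_not_mem_cyConn _ _)
  have hrγ : r ∉ range γ := not_mem_range_cyLoop hP (fun j _ => faceCenter_not_mem_cyDart _ _)
    (fun j _ => faceCenter_not_mem_cyConn _ _)
  have hcross : γ.crossInc ℓ r ≠ 0 := by
    rw [hγ, crossInc_cyLoop_eq n hP hd hc (toComplex_not_mem_cyDart _ _) (faceCenter_not_mem_cyDart _ _)]
    have key := crossInc_dartSeg_ne_zero (isCorner_faceAt q.1 q.2)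
    have h01 : ∀ v f : Site 2, (srcDir v f = 0 ∧ tgtDir v f = 1) ∨ (srcDir v f = 1 ∧ tgtDir v f = 0) := by
      intro v f; unfold srcDir tgtDir; split_ifs <;> simp
    rcases h01 (cyV β q 0) (cyF β q 0) with ⟨h0, h1⟩ | ⟨h0, h1⟩
    · rw [cyS, cyT, h0, h1]; exact key
    · rw [cyS, cyT, h0, h1, ← Path.segment_symm, Path.crossInc_symm]
      · exact neg_ne_zero.2 key
      · rw [Path.range_segment]; exact fun h' => toComplex_not_mem_dartSeg (isCorner_faceAt q.1 q.2) h'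
      · rw [Path.range_segment]; exact fun h' => faceCenter_not_mem_dartSeg (isCorner_faceAt q.1 q.2) h'
  intro hw
  rw [Path.crossInc_loop γ hℓγ hrγ, hw, sub_self, zero_mul] at hcross
  exact hcross rfl

/-- **(B) A vertex whose corner in the face of `q` is not on the cycle has the winding number of the
centre of that face**: the only dart piece meeting the half-diagonal from `v` into `faceAt v k` is the
one of the corner `(v, k)` (`cy_eq_of_mem_halfDiag`), and connectors miss half-diagonals. -/
private theorem wind_eq_center_N3 {β : BondConfig (Site 2)} {q : Site 2 × Fin 4} {n : ℕ}
    (hP : cornerOrbit β q (n + 1) = q) {v : Site 2} {k : Fin 4} (hf : faceAt v k = cFace q)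
    (hv : ∀ m, cornerOrbit β q m ≠ (v, k)) :
    wind (fun t => (cyLoop n hP).extend t - Site.toComplex v) =
      wind (fun t => (cyLoop n hP).extend t - faceCenter (cFace q)) := by
  refine wind_cyLoop_eq_of_segment hP fun z hz => not_mem_range_cyLoop hP (fun j _ hzj => ?_) (fun j _ hzj => ?_)
  · have hz' : z ∈ halfDiag v (faceAt v k) := by rw [halfDiag, hf]; exact hz
    exact hv j (cy_eq_of_mem_halfDiag j hzj hz')
  · have hz' : z ∈ halfDiag v (faceAt v k) := by rw [halfDiag, hf]; exact hz
    exact cyConn_disjoint_halfDiag j (isCorner_faceAt v k) hzj hz'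

/-- **Orbits avoid the arc `B`**: if the vertex of `c` is not on the discrete arc `B`, no corner of its
orbit under the turning rule of a completed configuration has its vertex on `B` (crossing a closed edge
keeps the vertex; a followed edge is open, and open edges have no endpoint on `B`). -/
private theorem fst_cornerOrbit_not_mem_zdArcB_N3 {D : DiscreteDobrushin} (hD : D.IsZdAdmissible)
    {ω : BondConfig (Site 2)} {c : Site 2 × Fin 4} (hc : c.1 ∉ D.zdArcB) (m : ℕ) :
    (cornerOrbit (D.bcBondConfig ω) c m).1 ∉ D.zdArcB := by
  induction m with
  | zero => exact hc
  | succ m ih =>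
    rw [cornerOrbit_succ]
    by_cases h : cTgt (cornerOrbit (D.bcBondConfig ω) c m) ∈ D.bcBondConfig ω
    · rw [nextCorner_of_mem h]
      exact fun hB => DiscreteDobrushin.not_mem_bcBondConfig_of_mem_zdArcB hD (Sym2.mem_mk_right _ _) hB h
    · rw [nextCorner_of_not_mem h]
      exact ih

/-! ## The three-sided box -/

section ThreeSided

open LatticeDobrushin

variable {W H : ℕ} (hE : (threeSided W H).toDobrushin.IsZdAdmissible) (ω : BondConfig (Site 2))

/-- **Sites of the wired arc are joined by open edges of the completed configuration**: the wired arc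
of the three-sided box is connected through `A`–`A` edges of the box (`preconnected_zdArcA_threeSided`),
and these are open in `β` (`mem_bcBondConfig_of_arcA`). -/
private theorem reachable_of_mem_zdArcA_N3 {a b : Site 2} (ha : a ∈ (threeSided W H).toDobrushin.zdArcA)
    (hb : b ∈ (threeSided W H).toDobrushin.zdArcA) :
    (openGraph ((threeSided W H).toDobrushin.bcBondConfig ω)).Reachable a b := by
  let φ : ((discreteDomainGraph (threeSided W H).toDobrushin.Ω (threeSided W H).toDobrushin.δ).induce
      (threeSided W H).toDobrushin.zdArcA) →g openGraph ((threeSided W H).toDobrushin.bcBondConfig ω) :=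
    { toFun := Subtype.val
      map_rel' := fun {u v} huv => by
        rw [openGraph_adj]
        refine ⟨DiscreteDobrushin.mem_bcBondConfig_of_arcA huv fun y hy => ?_,
          fun h' => huv.ne (Subtype.ext h')⟩
        rcases Sym2.mem_iff.1 hy with rfl | rfl
        exacts [u.2, v.2] }
  exact (preconnected_zdArcA_threeSided ⟨a, ha⟩ ⟨b, hb⟩).map φ

/-- **The passage lemma, contrapositive core.** With `0 < x < W`, `(x, 0)` joined to `a ∈ A` by
`β`-open edges, and the wall dart `((x, 0), 3)` absent from the exploration, a contradiction: steps
(A)–(D) of the module docstring. -/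
private theorem false_of_forall_ne_wallDart_N3 {x : ℕ} (hx1 : 1 ≤ x) (hxW : x + 1 ≤ W) {a : Site 2}
    (haA : a ∈ (threeSided W H).A)
    (hreach : (openGraph ((threeSided W H).toDobrushin.bcBondConfig ω)).Reachable ![(x : ℤ), 0] a)
    (hcon : ∀ k < DiscreteDobrushin.exitTime hE ω,
      cornerOrbit ((threeSided W H).toDobrushin.bcBondConfig ω) (DiscreteDobrushin.startCorner hE) k ≠
        (![(x : ℤ), 0], 3)) : False := by
  classical
  -- notation: the completed configuration `β`, the start corner `c₀`, the exit time `N`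
  obtain ⟨β, hβdef⟩ : ∃ β : BondConfig (Site 2), β = (threeSided W H).toDobrushin.bcBondConfig ω := ⟨_, rfl⟩
  obtain ⟨c₀, hc₀def⟩ : ∃ c₀ : Site 2 × Fin 4, c₀ = DiscreteDobrushin.startCorner hE := ⟨_, rfl⟩
  obtain ⟨N, hNdef⟩ : ∃ N : ℕ, N = DiscreteDobrushin.exitTime hE ω := ⟨_, rfl⟩
  have hc₀ : (threeSided W H).toDobrushin.IsStartCorner c₀ :=
    hc₀def ▸ DiscreteDobrushin.isStartCorner_startCorner hE
  have hN : ¬ (threeSided W H).toDobrushin.IsInnerFace (cFace (cornerOrbit β c₀ N)) := by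
    rw [hβdef, hc₀def, hNdef]; exact DiscreteDobrushin.not_isInnerFace_exitTime hE ω
  have hlt : ∀ k < N, (threeSided W H).toDobrushin.IsInnerFace (cFace (cornerOrbit β c₀ k)) := by
    rw [hβdef, hc₀def, hNdef]; exact fun k hk => DiscreteDobrushin.isInnerFace_of_lt_exitTime hE ω hk
  rw [← hβdef] at hreach
  rw [← hβdef, ← hc₀def, ← hNdef] at hcon
  have hβ : β ⊆ (zdGraph 2).edgeSet := hβdef ▸ bcBondConfig_subset_zd ω
  set q : Site 2 × Fin 4 := (![(x : ℤ), 0], 2) with hqdef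
  -- the site `(x, -1)` below `(x, 0)` is on the arc `B`, the wall edge between them is closed,
  -- and the successor of `q` is the wall dart `d = ((x, 0), 3)`
  have hxB : (![(x : ℤ), -1] : Site 2) ∈ (threeSided W H).toDobrushin.zdArcB := by
    rw [zdArcB_threeSided, Set.mem_setOf_eq]
    simp; omega
  have htgt : q.1 + cornerUnit (q.2 + 1) = ![(x : ℤ), -1] := by
    funext i; fin_cases i <;> simp [hqdef, cornerUnit]
  have hclosed : cTgt q ∉ β :=
    hβdef ▸ DiscreteDobrushin.not_mem_bcBondConfig_of_mem_zdArcB hE (Sym2.mem_mk_right _ _) (htgt ▸ hxB)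
  have hnext : nextCorner β q = (![(x : ℤ), 0], 3) := by
    rw [nextCorner_of_not_mem hclosed]; rfl
  have hfq : (threeSided W H).toDobrushin.IsInnerFace (cFace q) := by
    rw [isInnerFace_threeSided_iff]
    simp [hqdef, cFace, faceAt, cornerOff]; omega
  have hfd : (threeSided W H).toDobrushin.IsInnerFace (cFace ((![(x : ℤ), 0], 3) : Site 2 × Fin 4)) := by
    rw [isInnerFace_threeSided_iff]
    simp [cFace, faceAt, cornerOff]; omega
  have hfx : faceAt (![(x : ℤ), -1] : Site 2) 1 = cFace q := by
    funext i; fin_cases i <;> simp [hqdef, cFace, faceAt, cornerOff]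
  have hqB : q.1 ∉ (threeSided W H).toDobrushin.zdArcB := by
    rw [zdArcB_threeSided, Set.mem_setOf_eq]; simp [hqdef]
  -- the cycle `Z` through `q` (minimal period `n + 1`) and the interface cycle (minimal period `P₀`)
  have hqm : q.1 ∈ meshDomain (threeSided W H).toDobrushin.Ω (threeSided W H).toDobrushin.δ := by
    rw [LatticeDobrushin.meshDomain_eq, mem_threeSided_S]
    simp [hqdef]; omega
  obtain ⟨P, hP0, hP, hPmin⟩ := exists_min_period hE ω hqm
  rw [← hβdef] at hP hPmin
  obtain ⟨n, rfl⟩ : ∃ n, P = n + 1 := ⟨P - 1, by omega⟩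
  have hc₀m : c₀.1 ∈ meshDomain (threeSided W H).toDobrushin.Ω (threeSided W H).toDobrushin.δ :=
    DiscreteDobrushin.zdBoundary_subset_meshDomain _ (DiscreteDobrushin.zdArcA_subset_zdBoundary _ hc₀.mem_zdArcA)
  obtain ⟨P₀, hP₀0, hP₀, hP₀min⟩ := exists_min_period hE ω hc₀m
  rw [← hβdef] at hP₀ hP₀min
  -- `Z` misses the interface cycle: otherwise `q`, an inner corner, would be an exploration dart,
  -- and so would its successor `d`
  have hZ : ∀ m s, cornerOrbit β q m ≠ cornerOrbit β c₀ s := by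
    intro m s h
    obtain ⟨s', hs'⟩ := exists_eq_cornerOrbit_of_iterate hP₀0 hP₀ m h
    have hin : (threeSided W H).toDobrushin.IsInnerFace (cFace (cornerOrbit β c₀ s')) := by
      rw [← hs']; exact hfq
    subst hβdef
    rw [isInnerFace_cornerOrbit_iff hE hc₀ hN hlt hP₀0 hP₀ hP₀min] at hin
    have hq' : cornerOrbit ((threeSided W H).toDobrushin.bcBondConfig ω) c₀ (s' % P₀) = q := by
      rw [cornerOrbit_mod_period hP₀]; exact hs'.symm
    have hd' : cornerOrbit ((threeSided W H).toDobrushin.bcBondConfig ω) c₀ (s' % P₀ + 1) = (![(x : ℤ), 0], 3) := by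
      rw [cornerOrbit_succ, hq', hnext]
    rcases (Nat.succ_le_of_lt hin).lt_or_eq with h1 | h1
    · exact hcon _ h1 hd'
    · exact hN (by rw [← h1, hd']; exact hfd)
  -- no corner of `Z` sits at a `B`-vertex
  have hZB : ∀ m, (cornerOrbit β q m).1 ∉ (threeSided W H).toDobrushin.zdArcB :=
    hβdef ▸ fst_cornerOrbit_not_mem_zdArcB_N3 hE hqB
  -- (A) and (B)
  have hA := wind_ne_N3 hP hPmin
  have hBx := wind_eq_center_N3 hP hfx fun m hm => hZB m (by rw [hm]; exact hxB)
  -- (C) `(x, 0) ~ a ~ c₀.1` by open edges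
  have haA' : a ∈ (threeSided W H).toDobrushin.zdArcA := by rw [zdArcA_threeSided]; exact haA
  have hC1 := wind_cyLoop_eq_of_reachable hβ hP hreach
  have hC2 := wind_cyLoop_eq_of_reachable hβ hP (hβdef ▸ reachable_of_mem_zdArcA_N3 ω haA' hc₀.mem_zdArcA)
  -- (D) the start edge `e_a = {c₀.1, b₀}` misses the polygon
  have hadj₀ : (zdGraph 2).Adj c₀.1 (c₀.1 + cornerUnit c₀.2) := cSrc_mem_edgeSet _
  have hD1 : wind (fun t => (cyLoop n hP).extend t - Site.toComplex c₀.1) =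
      wind (fun t => (cyLoop n hP).extend t - Site.toComplex (c₀.1 + cornerUnit c₀.2)) := by
    refine wind_cyLoop_eq_of_adj_N3 hP hadj₀ fun m hm => ?_
    have hm' : cTgt (cornerOrbit β q m) = cTgt (c₀.1, c₀.2 + 3) := by rw [cTgt_crossPred c₀]; exact hm
    rcases cTgt_eq_cTgt_iff.1 hm' with h1 | h1
    · -- the cross-predecessor of `c₀`: its successor is `c₀`, not on `Z`
      refine hZ (m + 1) 0 ?_
      have hea : cTgt (c₀.1, c₀.2 + 3) ∉ β := by
        rw [cTgt_crossPred, hβdef]; exact cSrc_start_not_mem hE hc₀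
      subst hβdef
      rw [cornerOrbit_succ, h1, nextCorner_of_not_mem hea, cornerOrbit_zero]
      exact Prod.ext rfl (fin4_add_three_add_one _)
    · -- its partner sits at the `B`-vertex `b₀`
      refine hZB m ?_
      rw [h1, cornerPartner]
      change c₀.1 + cornerUnit (c₀.2 + 3 + 1) ∈ (threeSided W H).toDobrushin.zdArcB
      rw [fin4_add_three_add_one]
      exact hc₀.mem_zdArcB
  -- (D) the bottom row misses the polygon
  have hD2 : ∀ j : ℕ, j ≤ W → wind (fun t => (cyLoop n hP).extend t - Site.toComplex ![(j : ℤ), -1]) =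
      wind (fun t => (cyLoop n hP).extend t - Site.toComplex ![(0 : ℤ), -1]) := by
    intro j
    induction j with
    | zero => intro; simp
    | succ j ih =>
      intro hj
      have hadj : (zdGraph 2).Adj (![(j : ℤ), -1] : Site 2) ![((j + 1 : ℕ) : ℤ), -1] :=
        (zdGraph_adj_iff _ _).2 ⟨0, Or.inl (by funext i; fin_cases i <;> simp)⟩
      rw [← ih (by omega)]
      refine (wind_cyLoop_eq_of_adj_N3 hP hadj fun m hm => hZB m ?_).symm
      have hv : (cornerOrbit β q m).1 ∈ cTgt (cornerOrbit β q m) := Sym2.mem_mk_left _ _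
      rw [hm] at hv
      rw [zdArcB_threeSided, Set.mem_setOf_eq]
      rcases Sym2.mem_iff.1 hv with h | h <;> rw [h] <;> refine ⟨?_, ?_, ?_⟩ <;> simp <;> omega
  -- the lower endpoint `b₀` of `e_a` is on the bottom row
  have hb₀ : c₀.1 + cornerUnit c₀.2 ∈ (threeSided W H).toDobrushin.zdArcB := hc₀.mem_zdArcB
  generalize c₀.1 + cornerUnit c₀.2 = b at hb₀ hD1
  rw [zdArcB_threeSided, Set.mem_setOf_eq] at hb₀
  obtain ⟨hb0, hb0', hb1⟩ := hb₀
  have hbeq : b = ![((b 0).toNat : ℤ), -1] := by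
    have h0 := Int.toNat_of_nonneg hb0
    funext i; fin_cases i
    · simp [h0]
    · simp [hb1]
  have hD3 : wind (fun t => (cyLoop n hP).extend t - Site.toComplex b) =
      wind (fun t => (cyLoop n hP).extend t - Site.toComplex ![(0 : ℤ), -1]) := by
    rw [hbeq]; exact hD2 _ (by omega)
  -- the contradiction
  exact hA (hC1.trans <| hC2.trans <| hD1.trans <| hD3.trans <| (hD2 x (by omega)).symm.trans hBx)

end ThreeSided

/-- **The planar passage lemma at the free wall of the three-sided box** (necessity certificate, piece
N3). In the three-sided box `threeSided W H` with admissible realisation `E`, for every configuration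
`ω` and every wall-adjacent site `(x, 0)` with `0 < x < W`: if `(x, 0)` is joined to a wired site `a ∈ A`
by edges of the completed configuration `E.bcBondConfig ω`, then the east-going wall dart `((x, 0), 3)`
lies on the cut orbit of the start corner before the exit time, i.e. it is a dart of the medial
exploration path. Planar duality: otherwise the cycle of the turning rule through `((x, 0), 2)` has a
closed perturbed polygon with respect to which `(x, 0)` and the bottom row have different winding
numbers, while open edges, `A`–`A` edges, the start edge and the bottom-row edges all miss it. -/
theorem threeSided_wallDart_of_joined : ∀ (W H : ℕ) (hE : (LatticeDobrushin.threeSided W H).toDobrushin.IsZdAdmissible) (ω : BondConfig (Site 2)) (x : ℕ), 1 ≤ x → x + 1 ≤ W → (∃ a ∈ (LatticeDobrushin.threeSided W H).A, (openGraph ((LatticeDobrushin.threeSided W H).toDobrushin.bcBondConfig ω)).Reachable ![(x : ℤ), 0] a) → ∃ k < DiscreteDobrushin.exitTime hE ω, cornerOrbit ((LatticeDobrushin.threeSided W H).toDobrushin.bcBondConfig ω) (DiscreteDobrushin.startCorner hE) k = (![(x : ℤ), 0], 3) := by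
  intro W H hE ω x hx1 hxW hjoined
  obtain ⟨a, haA, hreach⟩ := hjoined
  by_contra hcon
  push Not at hcon
  exact false_of_forall_ne_wallDart_N3 hE ω hx1 hxW haA hreach hcon

end

end Summit.CriticalPhenomena.CardyFormulaZ2.Cruxes.EdgePrecompact.QkzStripBoundaryArm
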